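import Summits.Ventures.GridStability.Lyapunov.RelativeLffNonUniformRegion
import Summits.Ventures.GridStability.Lyapunov.WSCC9LffNonUniformRoa
import HarnessLib

/-!
# GridStability/Lyapunov/WSCC9LffNonUniformRegion — the GENERIC non-uniform-damping theorem applied to
# the instance of record «WSCC9-postB-L-SPdamp» (LFF-P1-NU, #30): a certified synchronisation region
# from SIGN FACTS ONLY, and the scalar test at the instance's own `(c′, h) = (1, 1/20)`

Venture GRIDFUSION, LFF lane; seat gridfusion-lyap-1 (g5). The instance of record (lyap-1 g4,
`WSCC9LffNonUniform{Data,,Roa}` p504302/p505072/p505678) certified the closed form by an `11 × 11`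
integer Gram certificate and six rank-one Gram facts. HERE the generic theorems of
`RelativeLffNonUniform{,RefT,Cert,Roa,Region}` (lyap-1 g5) are read on the SAME data
`WSCC9LffNU.data` (= `WSCC9.postB_relL` with the PRINTED damping `D_SP`, `D_i/M_i = 1/10, 1/5, 3/10`):

* `sys_eq` — g4's hand-typed system `WSCC9LffNU.sys` IS the generic `nuSystem data θ*` (`n = 2`);
* `X_posSemidef` — the residual of the closed form at g4's parameters `c′ = 1`, `h = 1/20` passes the
  SCALAR test of part 2 with `τ = 8` (`Σ M²/D ≤ 64·ΣD`, `M_i/D_i + 8 ≤ 20`): `X ⪰ 0` with NO matrix fact;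
* `exists_synchronisation_region` — from the sign facts of the data alone (`B_ij = B_ji > 0`, `G_ij = 0`
  off the diagonal, `M, D, C > 0`, `D_0/M_0 ≠ D_1/M_1`, acute circle points — g4's `abs_δs_lt`): a member of the family and
  a level `c₀ > V(0)` whose set `{𝒫, V ≤ c₀}` is kept by THE motion of `data.toModel` from every machine
  state in it, with all three speed deviations `→ 0` and both relative angles `→` equilibrium.

THREE COLUMNS. CERTIFIED (kernel): the three statements, for MODEL M′ = «WSCC9-postB-L-SPdamp» (synthetic
LOSSLESS variant of the printed 9-bus: post-fault-B network with transfer conductances dropped, block-C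
circle points, lossless redispatch `P′`) with the PRINTED NON-UNIFORM damping (MV-2L synthetic + MV-RD +
MV-SPD + MV-h12; NO MV-λ) — a PIPELINE sentence, not a 9-bus sentence. VALIDATED: nothing (no SDP, no
Gram certificate, no solver). No sentence of this file says that the WSCC 9-bus system or any grid is
stable. No definitions, no named fact; standard axioms.
-/

noncomputable section

open Real Set Filter Matrix Finset
open scoped Topology
open Literature.MathematicalPhysics.PowerSystems
open Literature.MathematicalPhysics.PowerSystems.LyapunovFunctionFamily
open InternalNode (refT)
open Summit.Ventures.GridStability.Models
open Summit.Ventures.GridStability.Lyapunov.RelativeLffNU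

namespace Summit.Ventures.GridStability.Lyapunov.WSCC9LffNU

/-! ### Sign facts of the data (kernel decisions over `ℚ`) -/

/-- `B` is symmetric. -/
theorem data_B_symm : ∀ i j : Fin 3, data.B i j = data.B j i := by decide +kernel

/-- Positive per-machine dampings. -/
theorem data_D_pos : ∀ i : Fin 3, 0 < data.D i := by decide +kernel

/-! ### g4's hand-typed system is the generic one -/

/-- **`WSCC9LffNU.sys = nuSystem data θ*`** (the instance of record is the generic object at `n = 2`). -/
theorem sys_eq : sys = nuSystem data data.angleOf := by
  unfold sys nuSystem sysOf System.machineReference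
  congr 1
  · congr 3
    funext i
    rw [ClassicalSwing.toLitNode_M]
    rfl
  · congr 1
    ext i k
    rw [inputOf_apply, Bω]
    simp only [Mv]
    ring

/-! ### The scalar test at the instance's own parameters -/

/-- `Σ M_i²/D_i ≤ 64·ΣD` (exact rational check; `τ = 8`). -/
theorem sum_sq_div_le : ∑ i, Mv data i ^ 2 / Dv data i ≤ 8 ^ 2 * Dsum (Dv data) := by
  have h : ∑ i : Fin 3, data.M i ^ 2 / data.D i ≤ 8 ^ 2 * ∑ i : Fin 3, data.D i := by
    simp only [Fin.sum_univ_succ, Fin.sum_univ_zero]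
    decide +kernel
  simp only [Mv, Dv, Dsum]
  exact_mod_cast h

/-- `(1/20)·(M_i/D_i + 8) ≤ 1` for every machine (`M_i/D_i = 10, 5, 10/3`). -/
theorem scalar_test : ∀ i : Fin 3, 1 / 20 * (Mv data i / Dv data i + 8) ≤ 1 := by
  intro i
  have h : ∀ i : Fin 3, (1 : ℚ) / 20 * (data.M i / data.D i + 8) ≤ 1 := by decide +kernel
  have hi : (((1 : ℚ) / 20 * (data.M i / data.D i + 8) : ℚ) : ℝ) ≤ ((1 : ℚ) : ℝ) := by exact_mod_cast h i
  push_cast at hi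
  simpa [Mv, Dv] using hi

/-- **The residual `X = 2c′D − h(2M − (muᵀ + umᵀ)/ΣD)` at `c′ = 1`, `h = 1/20` is positive semidefinite by
the SCALAR test** (`τ = 8`) — no Gram certificate. -/
theorem X_posSemidef : (XOf (Mv data) (Dv data) (refT 2) (NinvD (Dv data)) 1 (1 / 20)).PosSemidef :=
  XOf_refT_posSemidef (Mv data) (Dv data) 1 (1 / 20) (fun i => by unfold Mv; exact_mod_cast data_M_pos i)
    (fun i => by unfold Dv; exact_mod_cast data_D_pos i) (by norm_num) (τ := 8) (by norm_num) sum_sq_div_le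
    scalar_test

/-! ### The generic theorem, applied -/

/-- **LFF-P1-NU FROM SIGN FACTS ONLY.** For M′ = «WSCC9-postB-L-SPdamp» (lossless 9-bus variant, PRINTED
non-uniform damping `D_i/M_i = 1/10, 1/5, 3/10`) there are a Vu–Turitsyn certificate `Λ` on Pai's
machine-reference space and a level `c₀ > V(0)` such that from EVERY machine state whose machine-reference
state `((ω_i)_i | ((δ_m − δ_0) − (θ*_m − θ*_0))_m)` lies in `{𝒫, V ≤ c₀}`: `data.toModel` has exactly one
solution on `ℝ`, it keeps `{𝒫, V ≤ c₀}` for all `t ≥ 0`, all three speed deviations `→ 0` and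
`δ_m − δ_0 → θ*_m − θ*_0` — obtained from `RelativeLffNU.exists_synchronisation_region` and the sign facts
of the data; no SDP, no Gram certificate. (The explicit-level row of record remains g4's p505678.)
MODELLED as LABEL; no sentence here says a grid is stable.
[cite: VuTuritsyn2016, §IV set ℛ; Pai1981, §3.6.3 eq. (3.45)] -/
theorem exists_synchronisation_region :
    ∃ Λ : Certificate (nuSystem data data.angleOf), ∃ c₀ : ℝ, Λ.V 0 < c₀ ∧
      ∀ x₀ : ClassicalSwing.State 3, data.lurieState data.angleOf x₀ ∈ (nuSystem data data.angleOf).polytope →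
        Λ.V (data.lurieState data.angleOf x₀) ≤ c₀ →
        (∃! c : ℝ → ClassicalSwing.State 3, c 0 = x₀ ∧ data.toModel.IsSolutionOn c univ) ∧
          ∀ c : ℝ → ClassicalSwing.State 3, c 0 = x₀ → data.toModel.IsSolutionOn c univ →
            (∀ t, 0 ≤ t → data.lurieState data.angleOf (c t) ∈ (nuSystem data data.angleOf).polytope ∧
                Λ.V (data.lurieState data.angleOf (c t)) ≤ c₀) ∧
              Tendsto (fun t => data.lurieState data.angleOf (c t)) atTop (𝓝 0) :=
  RelativeLffNU.exists_synchronisation_region data data_B_pos data_G_off data_B_symm data_eqData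
    data_M_pos data_D_pos data_Cc_pos ⟨0, 1, data_hlam⟩ abs_δs_lt

end Summit.Ventures.GridStability.Lyapunov.WSCC9LffNU

end
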